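import Literature.IUT.HodgeArakelov.ThetaSettingDUUAutOfCyclicKernelAutAtModelTate
import Literature.IUT.HodgeArakelov.ThetaSettingHextKummerTransvectionDiscreteAtModelTate
import Literature.AnabelianGeometry.EtaleTheta.SettingModelGfpLevelKernelRigidity
import Literature.AnabelianGeometry.EtaleTheta.SettingModelChiShearInner
import Literature.AnabelianGeometry.EtaleTheta.SettingModelTateTheta
import Literature.AnabelianGeometry.EtaleTheta.SettingModelChiBarKerHuu
import HarnessLib

/-!
# ONE-LAW-NEG (B2) «HEXT-KUMMER-NEG»: a κ-compatible, degree-preserving, NON-extendable automorphism of `Δ^tp_{X̲̲} = dUU l`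
# — the multitwist `a^l ↦ a^l b` (proof-only; `hextΔ_false_without_χ` at the Tate model)

S. Mochizuki, *The étale theta function …* [EtTh], Publ. RIMS **45** (2009), Prop. 2.4 p. 38 (extension of automorphisms of
`Π^tp_{X̲̲}`), Cor. 2.18 (i) p. 60, §1 pp. 12–14 (the Galois action on `Δ_X`, the Heisenberg quotient and its levels)
[cite: MochizukiEtTh2009, Cor 2.18(i) p.60].  Cell `abc-iut`, K-L6 slice, row «ONE-LAW-NEG@modelTate» file B (abc-iut-L6-lead gen 8,
§F v1.19er (B) GO 2026-08-27T07:10Z), seat abc-iut-w5-d169 (gen 13); part B2 over part B1 (`exists_transvection_cyclicKernel`) and file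
A0 (`exists_closureAut_of_cyclicKernelAut`, `exists_dUUAut_of_closureAut`, `mem_closure_eta_of_hHat_x_eq_zero`) BY NAME; further
inputs: abc-iut-L2-t6's `affTwist₃` / `affTwist₃Gfp` / `innB` / `shear`, abc-iut-L2-t1's `twist` / `bPow` / `hHat_eta`, abc-iut-L6-t13's
`exists_monoidHom_levelHom_comp_eq` (odd level), `Heis.pow_eq_one_of_odd` (`SettingModelChiBarKerHuu`).  PROOF-ONLY: no definition, no instance, no new named fact.

* `affTwist₃_kummer_eta` — the Kummer generator `τ̂ := affTwist₃ ⟨(ι1, ι2), 1⟩ = Inn(b) ∘ shear(2)` of the stage-2 action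
  (`actχq p 1 2 σ` for `χ σ = 1`, `κ_p σ = ι 1`, by `actχq_apply`) restricts on `η(F₂)` to `τ₀ : a ↦ bab, b ↦ b`.
* **`exists_continuousMulEquiv_dUU_kummerCompatible`** (`l ≥ 3` odd) — the transvection `T₀ : a^l ↦ a^l b` of B1 completes to
  `Θ ∈ Aut_top(dUU l)` which (i) preserves `pr₂`; (ii) COMMUTES with `affTwist₃Gfp ⟨(ι1, ι2), 1⟩` — the κ-law of the pair formalism
  (abc-iut-w5-d125 p503499) EXACTLY (density of `η(U)` in `W` and B1 (iii)); (iii) sends `A = (η a^l, l) ↦ (η(a^l b), l)`; (iv) is NOT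
  the restriction of ANY continuous endomorphism `Φ` of `Γ`: `Φ` descends to an endomorphism of `Heis(ℤ/l)` (L6-t13), `A = a^l` is an
  `l`-th power in `Γ` and every `l`-th power of `Heis(ℤ/l)` is trivial for odd `l` (`(x,y,z)^l = (lx, ly, lz + l(l−1)/2·xy)`), whereas
  `levelHom_l (η(a^l b)) = (0, 1, 0)`.
CELL READING (K-L6 hextΔ, one-law table of §F v1.19er (B)): the Kummer (κ) law ALONE does not force extendability —
`hextΔ_false_without_χ`; any decider of `hextΔ` at the model must USE the cyclotomic (χ) law.  By this seat's (B2) memo §3 the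
multitwist `Θ` PRESERVES the theta kernel `K_l`, so it says NOTHING for `hΘ` (whose κ-only decider (D-κ) stays open); dual to file A
(χ-compatible, `K_l`-moving) and to p505997 (no law).
HONEST LABEL.  Statements about OUR semi-synthetic model of the typed [EtTh] §1 interface (not the tempered `π₁` of a curve) and the
geometric shadow of OUR typed binder `hextΔ`; `hextΔ` itself (BOTH laws, all of `Aut_top(dUU l ⋊ G_{ℚ_p})`) is NOT decided here; nothing of
[EtTh] (refereed; there (Θ)/extension follow from the arithmetic core) or [IUTchII] (claim key `Mochizuki2012`, DISPUTED, D-0012) is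
asserted; no side is taken on [IUTchIII] Cor. 3.12; typed ≠ proved; nothing here says abc is proved or refuted.
bears_on: LADDER-ABC:A2.L-K (K-L6 «ONE-LAW-NEG@modelTate») → LADDER-FRONTIER F-A2 (M·L6) → rung 0 `Summit.ABC`.
-/

set_option autoImplicit false

noncomputable section

namespace Literature.AnabelianGeometry.EtaleTheta.SettingModel

open Literature.AnabelianGeometry.SemiGraphs Literature.GroupTheory.CombinatorialGroupTheory
open Multiplicative

/-- **The Kummer generator of the stage-2 action on `F̂₂` restricts to `a ↦ bab, b ↦ b` on `η(F₂)`**: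
`affTwist₃ ⟨(ι1, ι2), 1⟩ (η g) = η (τ₀ g)` (`Inn(b) ∘ shear(2)`; abc-iut-L2-t6's `affTwist₃`). [cite: MochizukiEtTh2009, §1 p.13] -/
theorem affTwist₃_kummer_eta (τ₀ : F₂ →* F₂) (hτ₀a : τ₀ (FreeGroup.of 0) = FreeGroup.of 1 * FreeGroup.of 0 * FreeGroup.of 1)
    (hτ₀b : τ₀ (FreeGroup.of 1) = FreeGroup.of 1) (g : F₂) :
    affTwist₃ (⟨(iotaZ (ofAdd 1), iotaZ (ofAdd 2)), 1⟩ : (ZH × ZH) ⋊[diagAut] MulAut ZH) (eta g) = eta (τ₀ g) := by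
  have key : (affTwist₃ (⟨(iotaZ (ofAdd 1), iotaZ (ofAdd 2)), 1⟩ : (ZH × ZH) ⋊[diagAut] MulAut ZH)).toMonoidHom.comp eta =
      eta.comp τ₀ := by
    refine FreeGroup.ext_hom _ _ fun i => ?_
    rw [MonoidHom.comp_apply, MonoidHom.comp_apply]
    change affTwist₃ _ (eta (FreeGroup.of i)) = eta (τ₀ (FreeGroup.of i))
    rw [affTwist₃_apply, SemidirectProduct.left, SemidirectProduct.right]
    fin_cases i
    · change innB (iotaZ (ofAdd 1)) (shear (iotaZ (ofAdd 2)) (twist 1 (eta (FreeGroup.of 0)))) = eta (τ₀ (FreeGroup.of 0))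
      rw [twist_one, shear_eta_of_zero, innB_apply, bPow_iotaZ, bPow_iotaZ, hτ₀a, toAdd_ofAdd, toAdd_ofAdd, zpow_one,
        map_mul, map_mul]
      rw [show (2 : ℤ) = 1 + 1 by norm_num, zpow_add, zpow_one]
      simp only [mul_assoc, mul_inv_cancel, mul_one]
    · change innB (iotaZ (ofAdd 1)) (shear (iotaZ (ofAdd 2)) (twist 1 (eta (FreeGroup.of 1)))) = eta (τ₀ (FreeGroup.of 1))
      rw [twist_one, shear_apply, shearEnd_eta_of_one, innB_apply, bPow_iotaZ, toAdd_ofAdd, zpow_one, hτ₀b,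
        mul_inv_cancel_right]
  exact DFunLike.congr_fun key g

/-- **ONE-LAW-NEG (B): a κ-COMPATIBLE, degree-preserving, NON-EXTENDABLE automorphism of `Δ^tp_{X̲̲} = dUU l`** (`l ≥ 3` odd).
The transvection `T₀ : a^l ↦ a^l b` of file B1 completes to `Θ ∈ Aut_top(dUU l)` which (i) preserves the degree `pr₂`;
(ii) COMMUTES with the Kummer generator `τ̂ = Inn(b) ∘ shear(2) = affTwist₃Gfp ⟨(ι1, ι2), 1⟩` of the stage-2 Galois action
(= `actχq p 1 2 σ` for `χ σ = 1`, `κ_p σ = ι 1`) — the κ-law of the pair formalism EXACTLY; (iii) sends `A = (η a^l, l)` to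
`(η (a^l b), l)`; (iv) is NOT the restriction of ANY continuous endomorphism `Φ` of `Γ`: `A = a^l` is an `l`-th power in `Γ`, every
`l`-th power dies in `Heis(ℤ/l)` (abc-iut-L6-t13's `exists_monoidHom_levelHom_comp_eq`), but `levelHom_l (η(a^l b)) = (0,1,0)`.
(By the (B2) memo §3, `Θ` PRESERVES `K_l` — it says nothing for `hΘ`; it is the `hextΔ_false_without_χ` negative.)
[cite: MochizukiEtTh2009, Cor 2.18(i) p.60] -/
theorem exists_continuousMulEquiv_dUU_kummerCompatible (l : ℕ+) (hl : 3 ≤ (l : ℕ)) (hodd : Odd (l : ℕ)) :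
    ∃ Θ : ↥(dUU l) ≃ₜ* ↥(dUU l),
      (∀ γ : ↥(dUU l), gfpSnd ((Θ γ : ↥(dUU l)) : Gfp) = gfpSnd (γ : Gfp)) ∧
      (∀ (γ : ↥(dUU l))
        (h : affTwist₃Gfp (⟨(iotaZ (ofAdd 1), iotaZ (ofAdd 2)), 1⟩ : (ZH × ZH) ⋊[diagAut] MulAut ZH) (γ : Gfp) ∈ dUU l),
        ((Θ ⟨_, h⟩ : ↥(dUU l)) : Gfp) =
          affTwist₃Gfp (⟨(iotaZ (ofAdd 1), iotaZ (ofAdd 2)), 1⟩ : (ZH × ZH) ⋊[diagAut] MulAut ZH)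
            ((Θ γ : ↥(dUU l)) : Gfp)) ∧
      (∃ (A : ↥(dUU l)), ((A : Gfp) : F₂hatT × Multiplicative ℤ) = (eta (FreeGroup.of 0 ^ (l : ℕ)), ofAdd ((l : ℕ) : ℤ)) ∧
        (((Θ A : ↥(dUU l)) : Gfp) : F₂hatT × Multiplicative ℤ) =
          (eta (FreeGroup.of 0 ^ (l : ℕ) * FreeGroup.of 1), ofAdd ((l : ℕ) : ℤ)) ∧
        ∀ Φ : Gfp →ₜ* Gfp, Φ (A : Gfp) ≠ ((Θ A : ↥(dUU l)) : Gfp)) := by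
  classical
  haveI : NeZero (l : ℕ) := ⟨l.ne_zero⟩
  haveI : Fact (1 < (l : ℕ)) := ⟨by omega⟩
  set gτ : (ZH × ZH) ⋊[diagAut] MulAut ZH := ⟨(iotaZ (ofAdd 1), iotaZ (ofAdd 2)), 1⟩ with hgτ
  -- §1 the discrete data
  let χ₀ : F₂ →* Multiplicative (ZMod l) :=
    FreeGroup.lift fun i : Fin 2 => if i = 0 then ofAdd (1 : ZMod l) else 1
  have hχ₀ : ∀ i, χ₀ (FreeGroup.of i) = if i = 0 then ofAdd (1 : ZMod l) else 1 := fun i => FreeGroup.lift_apply_of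
  let τ₀ : F₂ →* F₂ :=
    FreeGroup.lift fun i : Fin 2 => if i = 0 then FreeGroup.of 1 * FreeGroup.of 0 * FreeGroup.of 1 else FreeGroup.of 1
  have hτ₀a : τ₀ (FreeGroup.of 0) = FreeGroup.of 1 * FreeGroup.of 0 * FreeGroup.of 1 := FreeGroup.lift_apply_of
  have hτ₀b : τ₀ (FreeGroup.of 1) = FreeGroup.of 1 := FreeGroup.lift_apply_of
  let U : Subgroup Del := (χ₀.comp Del.val).ker
  obtain ⟨T₀, hdeg, hzl, hτmem, hcomm, A₀, hA₀, hTA₀⟩ := exists_transvection_cyclicKernel l hl χ₀ hχ₀ τ₀ hτ₀a hτ₀b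
  -- §2 transport (file A0)
  obtain ⟨W, Ψ, hmemW, heHat, hz, hΨη⟩ := exists_closureAut_of_cyclicKernelAut l χ₀ hχ₀ T₀ hdeg hzl
  obtain ⟨Θ, hΘ⟩ := exists_dUUAut_of_closureAut l W Ψ hmemW heHat hz
  have hlev : ∀ (N : ℕ+) (γ : Gfp), levelHom N γ = hHat N ((γ : F₂hatT × Multiplicative ℤ).1) := fun _ _ => rfl
  have hW_of : ∀ γ : ↥(dUU l), ((γ : Gfp) : F₂hatT × Multiplicative ℤ).1 ∈ W := fun γ => by
    rw [hmemW, ← hlev]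
    exact ((mem_dUU_iff l (γ : Gfp)).mp γ.2).1
  have hmemU : ∀ d : Del, d ∈ U → (((heisHom (Del.val d)).x : ℤ) : ZMod l) = 0 := fun d hd => by
    have h := chi0_eq_heisHom_x l χ₀ hχ₀ (Del.val d)
    rw [show χ₀ (Del.val d) = 1 from hd] at h
    simpa using congrArg toAdd h.symm
  have hηW : ∀ u : U, eta (Del.val (u : Del)) ∈ W := fun u => by
    rw [hmemW, hHat_eta, Heis.map_apply]
    change (Int.castRingHom (ZMod l)) (heisHom (Del.val (u : Del))).x = 0
    rw [eq_intCast]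
    exact hmemU _ u.2
  have hΨcongr : ∀ (x y : F₂hatT) (hx : x ∈ W) (hy : y ∈ W), x = y → ((Ψ ⟨x, hx⟩ : W) : F₂hatT) = ((Ψ ⟨y, hy⟩ : W) : F₂hatT) :=
    fun x y hx hy h => by subst h; rfl
  -- §3 the κ-law: `Ψ` commutes with `τ̂` on `W`
  have hτW : ∀ {w : F₂hatT}, w ∈ W → affTwist₃ gτ w ∈ W := fun {w} hw => by
    rw [hmemW, hgτ, hHat_affTwist₃_x]
    exact (hmemW w).mp hw
  have hkey : ∀ (w : F₂hatT) (hw : w ∈ W),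
      ((Ψ ⟨affTwist₃ gτ w, hτW hw⟩ : W) : F₂hatT) = affTwist₃ gτ ((Ψ ⟨w, hw⟩ : W) : F₂hatT) := by
    let tW : W →* W := ((affTwist₃ gτ).toMonoidHom.comp W.subtype).codRestrict W fun w => hτW w.2
    let FL : W →* F₂hatT := (W.subtype.comp Ψ.toMonoidHom).comp tW
    let FR : W →* F₂hatT := (affTwist₃ gτ).toMonoidHom.comp (W.subtype.comp Ψ.toMonoidHom)
    have hFL : ∀ w : W, FL w = ((Ψ ⟨affTwist₃ gτ (w : F₂hatT), hτW w.2⟩ : W) : F₂hatT) := fun _ => rfl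
    have hFR : ∀ w : W, FR w = affTwist₃ gτ ((Ψ w : W) : F₂hatT) := fun _ => rfl
    have hFLc : Continuous FL :=
      continuous_subtype_val.comp (Ψ.continuous.comp (((continuous_affTwist₃ gτ).comp continuous_subtype_val).subtype_mk _))
    have hFRc : Continuous FR := (continuous_affTwist₃ gτ).comp (continuous_subtype_val.comp Ψ.continuous)
    let ιU : U →* W := (eta.comp (Del.val.comp U.subtype)).codRestrict W fun u => hηW u
    have hιU : ∀ u : U, ((ιU u : W) : F₂hatT) = eta (Del.val (u : Del)) := fun _ => rfl
    have hdense : DenseRange ιU := by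
      intro w
      rw [Topology.IsEmbedding.subtypeVal.closure_eq_preimage_closure_image, Set.mem_preimage]
      have himg : Subtype.val '' Set.range ιU = Set.range fun u : U => eta (Del.val (u : Del)) := by
        ext y
        constructor
        · rintro ⟨w', ⟨u, rfl⟩, rfl⟩
          exact ⟨u, rfl⟩
        · rintro ⟨u, rfl⟩
          exact ⟨ιU u, ⟨u, rfl⟩, rfl⟩
      rw [himg]
      exact mem_closure_eta_of_hHat_x_eq_zero l χ₀ hχ₀ ((hmemW _).mp w.2)
    have hgen : ∀ u : U, FL (ιU u) = FR (ιU u) := fun u => by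
      rw [hFL, hFR]
      -- `τ̂ (η u) = η (τ₀ u) = η (val v)` with `v ∈ U`
      let v : U := ⟨Del.ofF₂ (τ₀ (Del.val (u : Del))), hτmem u⟩
      have hv : Del.val (v : Del) = τ₀ (Del.val (u : Del)) := rfl
      have e1 : ((Ψ ⟨affTwist₃ gτ ((ιU u : W) : F₂hatT), hτW (ιU u).2⟩ : W) : F₂hatT) =
          ((Ψ ⟨eta (Del.val (v : Del)), hηW v⟩ : W) : F₂hatT) :=
        hΨcongr _ _ _ _ (by rw [hιU, affTwist₃_kummer_eta τ₀ hτ₀a hτ₀b, hv])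
      have e2 : ((Ψ (ιU u) : W) : F₂hatT) = ((Ψ ⟨eta (Del.val (u : Del)), hηW u⟩ : W) : F₂hatT) := hΨcongr _ _ _ _ rfl
      rw [e1, e2, hΨη v (hηW v), hΨη u (hηW u), hcomm u v hv, ← affTwist₃_kummer_eta τ₀ hτ₀a hτ₀b]
    have hall : (FL : W → F₂hatT) = FR := hdense.equalizer hFLc hFRc (funext hgen)
    intro w hw
    have := congrFun hall ⟨w, hw⟩; rw [hFL, hFR] at this; exact this
  -- §4 the element `A = (η a^l, l)` and its companion `a = (η a, 1)`
  have hvA₀ : Del.val (A₀ : Del) = FreeGroup.of 0 ^ (l : ℕ) := hA₀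
  have haG : ((eta (FreeGroup.of 0), ofAdd (1 : ℤ)) : F₂hatT × Multiplicative ℤ) ∈ Gfp := by
    rw [mem_Gfp, eHat_eta, expA_apply, heisHom_of_zero]
  have hAG : ((eta (FreeGroup.of 0 ^ (l : ℕ)), ofAdd ((l : ℕ) : ℤ)) : F₂hatT × Multiplicative ℤ) ∈ Gfp := by
    rw [mem_Gfp, eHat_eta, expA_apply, heisHom_pow_of_zero]
  have hApow : (⟨_, hAG⟩ : Gfp) = (⟨_, haG⟩ : Gfp) ^ (l : ℕ) := by
    refine Subtype.ext (Prod.ext ?_ ?_)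
    · change eta (FreeGroup.of 0 ^ (l : ℕ)) = ((((⟨_, haG⟩ : Gfp) ^ (l : ℕ) : Gfp)) : F₂hatT × Multiplicative ℤ).1
      rw [SubmonoidClass.coe_pow, Prod.pow_fst, map_pow]
    · change ofAdd ((l : ℕ) : ℤ) = ((((⟨_, haG⟩ : Gfp) ^ (l : ℕ) : Gfp)) : F₂hatT × Multiplicative ℤ).2
      rw [SubmonoidClass.coe_pow, Prod.pow_snd, ← ofAdd_nsmul, nsmul_eq_mul, mul_one]
  have hAdUU : (⟨_, hAG⟩ : Gfp) ∈ dUU l := by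
    rw [mem_dUU_iff, hlev]
    change (hHat l (eta (FreeGroup.of 0 ^ (l : ℕ)))).x = 0 ∧ (hHat l (eta (FreeGroup.of 0 ^ (l : ℕ)))).z = 0
    rw [hHat_eta, heisHom_pow_of_zero, Heis.map_apply]
    exact ⟨by simp, by simp⟩
  have hΘA : (((Θ ⟨_, hAdUU⟩ : ↥(dUU l)) : Gfp) : F₂hatT × Multiplicative ℤ) =
      (eta (FreeGroup.of 0 ^ (l : ℕ) * FreeGroup.of 1), ofAdd ((l : ℕ) : ℤ)) := by
    rw [hΘ ⟨_, hAdUU⟩ (hW_of _)]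
    refine Prod.ext ?_ rfl
    change ((Ψ ⟨eta (FreeGroup.of 0 ^ (l : ℕ)), hW_of ⟨_, hAdUU⟩⟩ : W) : F₂hatT) = eta (FreeGroup.of 0 ^ (l : ℕ) * FreeGroup.of 1)
    rw [hΨcongr _ _ _ (hηW A₀) (by rw [hvA₀]), hΨη A₀ (hηW A₀), hTA₀]
  refine ⟨Θ, fun γ => ?_, fun γ h => ?_, ⟨⟨_, hAdUU⟩, rfl, hΘA, fun Φ hΦ => ?_⟩⟩
  · -- (i) degree
    rw [gfpSnd_apply, gfpSnd_apply, hΘ γ (hW_of γ)]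
  · -- (ii) the κ-law
    refine Subtype.ext ?_
    rw [hΘ ⟨_, h⟩ (hW_of ⟨_, h⟩)]
    refine Prod.ext ?_ ?_
    · change ((Ψ ⟨affTwist₃ gτ ((γ : Gfp) : F₂hatT × Multiplicative ℤ).1, hW_of ⟨_, h⟩⟩ : W) : F₂hatT) =
        affTwist₃ gτ (((Θ γ : ↥(dUU l)) : Gfp) : F₂hatT × Multiplicative ℤ).1
      rw [hΘ γ (hW_of γ)]
      exact hkey _ (hW_of γ)
    · change ((γ : Gfp) : F₂hatT × Multiplicative ℤ).2 = (((Θ γ : ↥(dUU l)) : Gfp) : F₂hatT × Multiplicative ℤ).2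
      rw [hΘ γ (hW_of γ)]
  · -- (iv) not extendable
    obtain ⟨ε, hε⟩ := exists_monoidHom_levelHom_comp_eq Φ l hodd
    have h1 : levelHom l (Φ (⟨_, hAG⟩ : Gfp)) = 1 := by
      rw [hε, hApow, map_pow, map_pow, Heis.pow_eq_one_of_odd l hodd]
    have h2 : levelHom l (Φ (⟨_, hAG⟩ : Gfp)) = ⟨0, 1, 0⟩ := by
      change levelHom l (Φ ((⟨_, hAdUU⟩ : ↥(dUU l)) : Gfp)) = _
      rw [hΦ, hlev, hΘA]
      change hHat l (eta (FreeGroup.of 0 ^ (l : ℕ) * FreeGroup.of 1)) = _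
      rw [hHat_eta, map_mul, heisHom_pow_of_zero, heisHom_of_one]
      ext <;> simp
    rw [h1] at h2
    have hy := congrArg Heis.y h2
    simp at hy

end Literature.AnabelianGeometry.EtaleTheta.SettingModel

end
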